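import Summits.QuantumFields.YangMills.Theorems.AllWindowsColdBoxBoxHighLineSkinRow
import Summits.QuantumFields.YangMills.Theorems.AllWindowsColdBoxBoxHighLineSchurCoercive

/-!
# LINE-19 S3 CLOSED: input (h3) (decay of the skin Schur complement) and **`stub_landauKernelBounds`**

The last block input of `RestBlock.landauKernelBounds_of_inputs` (file `…SchurBlocks`): `|schurSkin s s'|·(1 + d_∞(s,s'))⁴ ≤ c₃`
(`schurSkin_decay_bound`).  With `schurSkin = A − C·K⁻¹·Cᵀ`: the entry `A(s,s') = hodgeQ(s,s')` is local (`skinRow` of an indicator), and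
`(C·K⁻¹·Cᵀ)(s,s')` is the skin row at `s` of the column `z ↦ (K⁻¹Cᵀ)((z,i), s')`, itself the skin row at `s'` of the two-sided rest kernel
`Kx i z ·` (`glue_colVec`); the two rows take one transverse difference each, so every term is a mixed second difference of `Kx`, bounded by
`Kx_hessian_bound`.  Then **`stub_landauKernelBounds : LandauVarianceBounded ∧ LandauKernelDecay`** — stub S3 of LINE-19
(⟨stmt-QuantumFields-24004⟩ / ⟨24335⟩; = U1a + S3b of LINE-20 ⟨24336⟩) BY NAME, from (h1) `restInv_size_bound`, (h2)
`restInv_coupling_bound`, (J′2) `schurSkin_coercive`, (h3), and the abstract Schur–Jaffard theorem.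

Everything proved; standard axioms.  HONEST LABEL: closes the registered stub S3 (`LandauVarianceBounded ∧ LandauKernelDecay`) of a
critic-stamped line on the R2ξ″ all-windows crux; the crux ⟨24004⟩, its children and the rung are NOT proved by this file (stubs S4/S5/U5/U6
remain); no summit is proved; the Yang–Mills mass gap is NOT proved here.
-/

set_option autoImplicit false

noncomputable section

namespace Summit.QuantumFields.YangMills.Theorems.AllWindowsColdBoxBoxHighLine

open Finset Matrix
open Literature.Probability.LatticeModels (Site)
open Literature.MathematicalPhysics.QuantumFieldTheory
open Literature.MathematicalPhysics.QuantumFieldTheory.LatticeMaxwell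
open Literature.MathematicalPhysics.QuantumFieldTheory.AxialGauge
open Summit.QuantumFields.YangMills.Theorems.WeakCouplingRates
open Summit.QuantumFields.YangMills.Theorems.AllWindowsColdBox.BoxKernel

namespace RestBlock

variable {H : ℕ}

/-! ## The column `z ↦ (K⁻¹Cᵀ)((z, i), s')` -/

/-- The skin row at `s'` of the two-sided rest kernel with first point `z` (direction `i`): for a rest link `(z, i)` this is
`(restInv * couplingᵀ)((z,i), s')`, and it vanishes otherwise. -/
def Theta [NeZero (2 * H)] (s' : Skin H) (i : Fin 4) (z : Site 4) : ℝ :=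
  skinRow s'.1.1.1.1 s'.1.1.1.2 (fun f => if f.2 = i then Kx H i z f.1 else 0)

/-- The skin row of the zero function vanishes. -/
theorem skinRow_zero (y : Site 4) (μ : Fin 4) : skinRow y μ (fun _ => 0) = 0 := by
  simp [skinRow, circ]

/-- `Theta` vanishes unless `(z, i)` is a rest link. -/
theorem Theta_of_not_isRest [NeZero (2 * H)] (s' : Skin H) {i : Fin 4} {z : Site 4} (h : ¬ IsRest H z i) : Theta s' i z = 0 := by
  unfold Theta
  have : (fun f : Literature.MathematicalPhysics.QuantumLattice.ZdEdge 4 => if f.2 = i then Kx H i z f.1 else 0) = fun _ => 0 := by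
    funext f; split_ifs <;> simp [Kx_of_not_isRest_fst h]
  rw [this, skinRow_zero]

/-- `Theta` at a rest link is the entry of `restInv * couplingᵀ`. -/
theorem Theta_of_rest [NeZero (2 * H)] (hH : 1 ≤ H) (s' : Skin H) (r : Rest H) :
    Theta s' r.1.1.1.2 r.1.1.1.1 = (restInv H * (coupling H)ᵀ) r s' := by
  rw [restInv_mul_couplingT_apply,
    hodgeQ_mulVec_skin s' (restVec r) (fun f => if f.2 = r.1.1.1.2 then restKer r f.1 else 0)
      (funext fun f => (glue_restVec hH r f.1 f.2).symm)]
  unfold Theta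
  congr 1
  funext f
  split_ifs
  · rw [restKer_eq_Kx]
  · rfl

/-- The rest-supported column vector `e ↦ (restInv * couplingᵀ)(e, s')`. -/
def colVec (s' : Skin H) (e : LandauFree H) : ℝ :=
  if h : (e.1.1.1 ∈ interiorSites H ∨ e.1.1.1 + Pi.single e.1.1.2 1 ∈ interiorSites H) then (restInv H * (coupling H)ᵀ) ⟨e, h⟩ s'
  else 0

/-- **The zero extension of the column vector is `Theta`.** -/
theorem glue_colVec [NeZero (2 * H)] (hH : 1 ≤ H) (s' : Skin H) (z : Site 4) (i : Fin 4) :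
    glue (pin := landauPin H) dirCorner (2 * H + 3) 0 (colVec s') (z, i) = Theta s' i z := by
  unfold glue
  by_cases hblock : (z, i) ∈ boxEdgesAt dirCorner (2 * H + 3)
  · rw [dif_pos hblock]
    by_cases hpin : landauPin H (z, i)
    · rw [dif_pos hpin]
      have hz : ¬ IsRest H z i := fun hc => hpin (mem_boxEdges_of_isRest hc)
      rw [Theta_of_not_isRest s' hz]; rfl
    · rw [dif_neg hpin]
      unfold colVec
      by_cases hmem : (z ∈ interiorSites H ∨ z + Pi.single i 1 ∈ interiorSites H)
      · rw [dif_pos hmem]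
        exact (Theta_of_rest hH s' ⟨⟨⟨(z, i), hblock⟩, hpin⟩, hmem⟩).symm
      · rw [dif_neg hmem]
        have hz : ¬ IsRest H z i := fun hc => hmem (mem_or_mem_of_isRest hH hc)
        rw [Theta_of_not_isRest s' hz]
  · rw [dif_neg hblock]
    have hz : ¬ IsRest H z i := fun hc => hblock (mem_boxEdgesAt_of_isRest hc)
    rw [Theta_of_not_isRest s' hz]

/-- **The Schur complement entry as a difference of two skin rows**: the local entry `hodgeQ(s, s')` minus the skin row at `s` of `Theta`. -/
theorem schurSkin_apply [NeZero (2 * H)] (hH : 1 ≤ H) (s s' : Skin H) :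
    schurSkin H s s' = skinRow s.1.1.1.1 s.1.1.1.2 (ind s'.1) - skinRow s.1.1.1.1 s.1.1.1.2 (fun f => Theta s' f.2 f.1) := by
  have hA : skinBlock H s s' = skinRow s.1.1.1.1 s.1.1.1.2 (ind s'.1) := by
    rw [← hodgeQ_mulVec_skin s (Pi.single s'.1 1) (ind s'.1) (glue_zero_single s'.1).symm, Matrix.mulVec_single_one]
    rfl
  have hB : (coupling H * restInv H * (coupling H)ᵀ) s s' = skinRow s.1.1.1.1 s.1.1.1.2 (fun f => Theta s' f.2 f.1) := by
    rw [← hodgeQ_mulVec_skin s (colVec s') (fun f => Theta s' f.2 f.1) (funext fun f => (glue_colVec hH s' f.1 f.2).symm),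
      Matrix.mul_assoc, Matrix.mul_apply, Matrix.mulVec, dotProduct, ← Equiv.sum_comp (skinRest H), Fintype.sum_sum_type]
    have h0 : ∑ t : Skin H, hodgeQ H s.1 (skinRest H (Sum.inl t)) * colVec s' (skinRest H (Sum.inl t)) = 0 := by
      refine Finset.sum_eq_zero fun t _ => ?_
      rw [skinRest_inl]; unfold colVec; rw [dif_neg t.2, mul_zero]
    rw [h0, zero_add]
    refine Finset.sum_congr rfl fun r _ => ?_
    rw [skinRest_inr]
    unfold colVec
    rw [dif_pos r.2]
    rfl
  rw [schurSkin, Matrix.sub_apply, hA, hB]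

/-! ## The bounds -/

/-- Moving both base points by at most three steps costs at most a factor `256` in the quartic weight. -/
theorem weight4_shift3_le {a b c d : ℝ} (h : |a - b| ≤ |c - d| + 3) : (1 + |a - b|) ^ 4 ≤ 256 * (1 + |c - d|) ^ 4 := by
  have h0 : 0 ≤ |c - d| := abs_nonneg _
  have h1 : 1 + |a - b| ≤ 4 * (1 + |c - d|) := by linarith
  calc (1 + |a - b|) ^ 4 ≤ (4 * (1 + |c - d|)) ^ 4 := pow_le_pow_left₀ (by positivity) h1 4
    _ = 256 * (1 + |c - d|) ^ 4 := by ring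

/-- The local part: an indicator entry near `s` forces `d_∞(s, s') ≤ 2`. -/
theorem ind_weight_le (s s' : Skin H) (w : Site 4) (k : Fin 4) (hw : ∀ κ, |w κ - s.1.1.1.1 κ| ≤ 2) :
    |ind s'.1 (w, k)| * (1 + linkDist s.1 s'.1) ^ 4 ≤ 81 := by
  rw [ind_apply]
  split_ifs with h
  · obtain ⟨κ, hκ⟩ := exists_linkDist_eq s.1 s'.1
    have h1 : |((s.1.1.1.1 κ - s'.1.1.1.1 κ : ℤ) : ℝ)| ≤ 2 := by
      rw [h.1]; have := hw κ; rw [abs_sub_comm] at this; exact_mod_cast this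
    rw [abs_one, one_mul, hκ]
    calc (1 + |((s.1.1.1.1 κ - s'.1.1.1.1 κ : ℤ) : ℝ)|) ^ 4 ≤ (3 : ℝ) ^ 4 := pow_le_pow_left₀ (by positivity) (by linarith) 4
      _ = 81 := by norm_num
  · rw [abs_zero, zero_mul]; norm_num


/-- **(h3)**: `|schurSkin s s'|·(1 + d_∞(s, s'))⁴ ≤ c₃`, uniformly in `H`. -/
theorem schurSkin_decay_bound : ∃ c₃ : ℝ, 0 ≤ c₃ ∧ ∀ H : ℕ, 1 ≤ H → ∀ s s' : Skin H,
    |schurSkin H s s'| * (1 + linkDist s.1 s'.1) ^ (4 : ℝ) ≤ c₃ := by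
  obtain ⟨C, hC0, hK⟩ := Kx_hessian_bound
  refine ⟨16 * 324 + 16 * (2 * (16 * (2 * (256 * C)))), by positivity, fun H hH s s' => ?_⟩
  haveI : NeZero (2 * H) := ⟨by omega⟩
  rw [show ((4 : ℝ)) = ((4 : ℕ) : ℝ) by norm_num, Real.rpow_natCast, schurSkin_apply hH s s']
  set y := s.1.1.1.1 with hy
  set μ := s.1.1.1.2 with hμ
  set y' := s'.1.1.1.1 with hy'
  set μ' := s'.1.1.1.2 with hμ'
  set W : ℝ := (1 + linkDist s.1 s'.1) ^ 4 with hW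
  have hW0 : 0 ≤ W := by have := linkDist_nonneg s.1 s'.1; positivity
  obtain ⟨κ, hκ⟩ := exists_linkDist_eq s.1 s'.1
  rw [← hy, ← hy'] at hκ
  -- (a) the local entry
  have ha : |skinRow y μ (ind s'.1)| * W ≤ 16 * 324 := by
    refine skinRow_bound y μ (ind s'.1) W 324 hW0 (by norm_num) fun z i j _ hz => ?_
    have hp : ∀ (w : Site 4), (∀ κ, |w κ - z κ| ≤ 1) → |ind s'.1 (w, i)| * W ≤ 81 ∧ |ind s'.1 (w, j)| * W ≤ 81 := by
      intro w hwz
      have hwy : ∀ κ, |w κ - y κ| ≤ 2 := fun κ => by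
        have := abs_sub_le (w κ) (z κ) (y κ); have := hwz κ; have := hz κ; linarith
      exact ⟨ind_weight_le s s' w i hwy, ind_weight_le s s' w j hwy⟩
    have h0 : ∀ κ, |z κ - z κ| ≤ 1 := fun κ => by simp
    have h1 : ∀ (l : Fin 4) κ, |(z + Pi.single l 1 : Site 4) κ - z κ| ≤ 1 := by
      intro l κ; simp only [Pi.add_apply, Pi.single_apply]; split_ifs <;> simp
    have e1 := (hp z h0).1
    have e2 := (hp (z + Pi.single i 1) (h1 i)).2
    have e3 := (hp (z + Pi.single j 1) (h1 j)).1
    have e4 := (hp z h0).2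
    unfold circ
    -- `|a + b − c − d| ≤ |a| + |b| + |c| + |d|`
    have h4 : |ind s'.1 (z, i) + ind s'.1 (z + Pi.single i 1, j) - ind s'.1 (z + Pi.single j 1, i) - ind s'.1 (z, j)| ≤
        |ind s'.1 (z, i)| + |ind s'.1 (z + Pi.single i 1, j)| + |ind s'.1 (z + Pi.single j 1, i)| + |ind s'.1 (z, j)| := by
      have g1 := abs_sub (ind s'.1 (z, i) + ind s'.1 (z + Pi.single i 1, j) - ind s'.1 (z + Pi.single j 1, i)) (ind s'.1 (z, j))
      have g2 := abs_sub (ind s'.1 (z, i) + ind s'.1 (z + Pi.single i 1, j)) (ind s'.1 (z + Pi.single j 1, i))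
      have g3 := abs_add_le (ind s'.1 (z, i)) (ind s'.1 (z + Pi.single i 1, j))
      linarith
    have h5 := mul_le_mul_of_nonneg_right h4 hW0
    rw [add_mul, add_mul, add_mul] at h5
    linarith
  -- (b) one transverse difference of `Theta`
  have hb : ∀ (z : Site 4) (i j : Fin 4), j ≠ i → (∀ κ, |z κ - y κ| ≤ 1) →
      |Theta s' i (z + Pi.single j 1) - Theta s' i z| * W ≤ 16 * (2 * (256 * C)) := by
    intro z i j hj hz
    unfold Theta
    rw [← skinRow_sub]
    refine skinRow_bound y' μ' _ W (2 * (256 * C)) hW0 (by positivity) fun w k l hkl hw => ?_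
    -- the weight at the pair `(z, w)`
    have hWzw : ∀ w₀ : Site 4, (∀ κ, |w₀ κ - y' κ| ≤ 2) → W ≤ 256 * (1 + |((z κ - w₀ κ : ℤ) : ℝ)|) ^ 4 := by
      intro w₀ hw₀
      rw [hW, hκ]
      push_cast
      apply weight4_shift3_le
      have h1 := abs_sub_le (((y κ : ℤ) : ℝ)) (((z κ : ℤ) : ℝ)) (((y' κ : ℤ) : ℝ))
      have h2 := abs_sub_le (((z κ : ℤ) : ℝ)) (((w₀ κ : ℤ) : ℝ)) (((y' κ : ℤ) : ℝ))
      have h3 : |((y κ : ℤ) : ℝ) - ((z κ : ℤ) : ℝ)| ≤ 1 := by rw [abs_sub_comm]; exact_mod_cast hz κ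
      have h4 : |((w₀ κ : ℤ) : ℝ) - ((y' κ : ℤ) : ℝ)| ≤ 2 := by exact_mod_cast hw₀ κ
      linarith
    have hD : ∀ (w₀ : Site 4) (ν : Fin 4), ν ≠ i → (∀ κ, |w₀ κ - y' κ| ≤ 2) →
        |Kx H i (z + Pi.single j 1) (w₀ + Pi.single ν 1) - Kx H i z (w₀ + Pi.single ν 1) -
            (Kx H i (z + Pi.single j 1) w₀ - Kx H i z w₀)| * W ≤ 256 * C := by
      intro w₀ ν hν hw₀
      have h := hK H i j ν κ hj hν z w₀
      have e : Kx H i (z + Pi.single j 1) (w₀ + Pi.single ν 1) - Kx H i z (w₀ + Pi.single ν 1) -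
          (Kx H i (z + Pi.single j 1) w₀ - Kx H i z w₀) =
          Kx H i (z + Pi.single j 1) (w₀ + Pi.single ν 1) - Kx H i (z + Pi.single j 1) w₀ - Kx H i z (w₀ + Pi.single ν 1) +
            Kx H i z w₀ := by ring
      rw [e]
      calc _ ≤ |Kx H i (z + Pi.single j 1) (w₀ + Pi.single ν 1) - Kx H i (z + Pi.single j 1) w₀ - Kx H i z (w₀ + Pi.single ν 1) +
              Kx H i z w₀| * (256 * (1 + |((z κ - w₀ κ : ℤ) : ℝ)|) ^ 4) := mul_le_mul_of_nonneg_left (hWzw w₀ hw₀) (abs_nonneg _)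
        _ = 256 * (|Kx H i (z + Pi.single j 1) (w₀ + Pi.single ν 1) - Kx H i (z + Pi.single j 1) w₀ - Kx H i z (w₀ + Pi.single ν 1) +
              Kx H i z w₀| * (1 + |((z κ - w₀ κ : ℤ) : ℝ)|) ^ 4) := by ring
        _ ≤ 256 * C := mul_le_mul_of_nonneg_left h (by norm_num)
    have hw2 : ∀ κ, |w κ - y' κ| ≤ 2 := fun κ => by have := hw κ; linarith
    have hwk2 : ∀ κ, |(w + Pi.single k 1 : Site 4) κ - y' κ| ≤ 2 := fun κ => by
      have h1 : |(w + Pi.single k 1 : Site 4) κ - w κ| ≤ 1 := by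
        simp only [Pi.add_apply, Pi.single_apply]; split_ifs <;> simp
      have := abs_sub_le ((w + Pi.single k 1 : Site 4) κ) (w κ) (y' κ); have := hw κ; linarith
    unfold circ
    by_cases hk : k = i
    · have hl : l ≠ i := fun h => hkl (hk.trans h.symm)
      simp only [hk, hl, if_true, if_false, sub_self, add_zero, sub_zero]
      have h := hD w l hl hw2
      rw [abs_sub_comm] at h
      linarith
    · by_cases hl : l = i
      · simp only [hk, hl, if_true, if_false, sub_self, zero_add, sub_zero]
        have h := hD w k hk hw2
        linarith
      · simp only [hk, hl, if_false, sub_self, add_zero, abs_zero, zero_mul]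
        positivity
  -- (c) the skin row of `Theta` at `s`
  have hc : |skinRow y μ (fun f => Theta s' f.2 f.1)| * W ≤ 16 * (2 * (16 * (2 * (256 * C)))) := by
    refine skinRow_bound y μ _ W (2 * (16 * (2 * (256 * C)))) hW0 (by positivity) fun z i j hij hz => ?_
    unfold circ
    have h1 := hb z i j (Ne.symm hij) hz
    have h2 := hb z j i hij hz
    have e : Theta s' i z + Theta s' j (z + Pi.single i 1) - Theta s' i (z + Pi.single j 1) - Theta s' j z =
        (Theta s' j (z + Pi.single i 1) - Theta s' j z) - (Theta s' i (z + Pi.single j 1) - Theta s' i z) := by ring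
    rw [e]
    have h3 := mul_le_mul_of_nonneg_right (abs_sub (Theta s' j (z + Pi.single i 1) - Theta s' j z)
      (Theta s' i (z + Pi.single j 1) - Theta s' i z)) hW0
    rw [add_mul] at h3
    linarith
  have h3 := mul_le_mul_of_nonneg_right (abs_sub (skinRow y μ (ind s'.1)) (skinRow y μ (fun f => Theta s' f.2 f.1))) hW0
  rw [add_mul] at h3
  linarith

/-! ## S3 by name -/

/-- S3b alone (= U1a of LINE-20): Coulomb decay of the Landau/Hodge kernel of the cold box. -/
theorem landauKernelDecay : LandauKernelDecay := by
  obtain ⟨c₁, hc₁, h1⟩ := restInv_size_bound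
  obtain ⟨c₂, hc₂, h2⟩ := restInv_coupling_bound
  obtain ⟨c₃, hc₃, h3⟩ := schurSkin_decay_bound
  exact (landauKernelBounds_of_inputs hc₁ hc₂ hc₃ h1 h2 schurSkin_coercive h3).2

end RestBlock

/-- **Stub S3 of LINE-19 (`stub_landauKernelBounds`), BY NAME: bounded Landau variances and Coulomb decay of the Landau/Hodge kernel of
the cold box** — `LandauVarianceBounded ∧ LandauKernelDecay`, by the Schur–Jaffard block decay of `hodgeQ⁻¹` (the typed `(1 + log H)` is
slack: the bound holds without it). -/
theorem stub_landauKernelBounds : LandauVarianceBounded ∧ LandauKernelDecay := by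
  obtain ⟨c₁, hc₁, h1⟩ := RestBlock.restInv_size_bound
  obtain ⟨c₂, hc₂, h2⟩ := RestBlock.restInv_coupling_bound
  obtain ⟨c₃, hc₃, h3⟩ := RestBlock.schurSkin_decay_bound
  exact RestBlock.landauKernelBounds_of_inputs hc₁ hc₂ hc₃ h1 h2 RestBlock.schurSkin_coercive h3


namespace RestBlock

/-- **S3b in the SHARP form, without the logarithm**: `|hodgeQ⁻¹(e, e′)|·(1 + d_∞(e, e′))² ≤ C` uniformly in `H ≥ 1`
(re-tick of S3 on the LOW item ⟨stmt-QuantumFields-24335⟩; the input for the U1b/U1c instantiation). -/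
theorem hodgeQ_inv_decay_sharp : ∃ C : ℝ, 0 ≤ C ∧ ∀ H : ℕ, 1 ≤ H → ∀ e e' : LandauFree H,
    |(hodgeQ H)⁻¹ e e'| * (1 + linkDist e e') ^ (2 : ℝ) ≤ C := by
  obtain ⟨c₁, hc₁, h1⟩ := restInv_size_bound
  obtain ⟨c₂, hc₂, h2⟩ := restInv_coupling_bound
  obtain ⟨c₃, hc₃, h3⟩ := schurSkin_decay_bound
  obtain ⟨Cfin, hC0, hmain⟩ := Summit.QuantumFields.YangMills.Theorems.AllWindowsColdBox.Jaffard.schur_jaffard_decay.{0}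
    (DS := 3) (cS := 256) (c₁ := c₁) (c₂ := c₂) (c₃ := c₃) (m₀ := 1) (by norm_num) (by norm_num) (by norm_num) hc₁ hc₂ hc₃ one_pos
  refine ⟨Cfin, hC0, fun H hH e e' => ?_⟩
  haveI : NeZero H := ⟨by omega⟩
  letI : DecidableEq (Skin H ⊕ Rest H) := instDecidableEqSum
  have hm := hmain (sumDist H) (fun a b => linkDist_nonneg _ _) (fun a => linkDist_self _) (fun a b => linkDist_comm _ _)
    (fun a b c => linkDist_triangle _ _ _) (fun y ρ hρ => card_skin_ball_le (skinRest H y) ρ hρ) (skinBlock H) (coupling H)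
    (restBlock H) (restInv H) skinBlock_isSymm restInv_isSymm restBlock_mul_restInv (fun r r' => h1 H hH r r')
    (fun r s => h2 H hH r s) (schurSkin_coercive H hH) (fun s s' => h3 H hH s s') ((skinRest H).symm e) ((skinRest H).symm e')
  have hde : sumDist H ((skinRest H).symm e) ((skinRest H).symm e') = linkDist e e' := by simp [sumDist]
  rw [hde] at hm
  rw [hodgeQ_inv_apply e e']
  exact hm

end RestBlock

/-- Registry re-tick of S3 on ⟨stmt-QuantumFields-24004⟩ (the stub above was first filed in helper mode, ✓p731755): bounded variances and
Coulomb decay of the Landau kernel, restated as a usable `example` (no new declaration). -/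
example : LandauVarianceBounded ∧ LandauKernelDecay := stub_landauKernelBounds

/-- Registry re-tick of S3 on the LOW item ⟨stmt-QuantumFields-24335⟩ (twin of the ⟨24004⟩ tick): Coulomb decay of the Landau kernel,
a usable `example` (no new declaration). -/
example : LandauKernelDecay := stub_landauKernelBounds.2

end Summit.QuantumFields.YangMills.Theorems.AllWindowsColdBoxBoxHighLine

end
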